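import Summits.Ventures.WeilGRH.TwistedGramEntryBoxC
import Summits.Ventures.WeilGRH.TwistedGramCellSignsC
import Summits.Ventures.WeilGRH.TwistedGramCellCheck
import Summits.Ventures.WeilGRH.TwistedComplexDataRungJ
import HarnessLib

/-!
# GRH arm: twisted format C for COMPLEX characters — the κ-enumeration CELL checker for the door
  `weilPositivityOnChar_of_twistedC_formatC_dataJ` at order `J = 1`, `λ = 1` (kernel functions + soundness + literal `hS` bridge)

Cell `rh-explicit`, WEIL TRACK — GRH ARM (engine seat weil-grh-2 gen10).  Brick 3 of the complex χ-cell lane (bricks 1–2: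
`TwistedGramCellSignsC`, `TwistedGramEntryBoxC`).  Enumeration `κ`: index `i ↦ mode p = (i+1)/2` (i odd) / `−i/2` (i even);
records at negative modes are the FLIPPED table records (`IdxRec.flip`; `OffValid.flip`, and for the diagonal fields
`reDigammaQuarter_even` / `re_deriv_digamma_quarter_neg` / `archExpSumDiag_neg`).  Entry `M(i,i') = twistedGramCBox …`; Schur sum over
the columns `j ∈ [2B−1, 2B₃−1)` with weights `w j = wN[(j+1)/2 − B]·2^{−wbits}`; the door's order-1 two-sided tail for `J = 1`
(the `Fin 1` bracket collapses to `1/(B₃−1)`, both copies of the door's statement coincide):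
`U(i,i') = 2·[(1+θ)(1+η) A²/(π² d₀ (B₃−1)) s_i s_{i'} + (1+θ)(1+η⁻¹)/(d₀ (B₃−1)) (s_i F̃_i)(s_{i'} F̃_{i'}) + δ_{ii'} (1+θ⁻¹)(2B−1)/(3 d₀ (B₃−1)³)(4A′|κ_i|/π)²]`,
`A = π/4 + Σ + C/(π B₃)`, `A′ = π/4 + Σ + C/π`, `F̃_i = (½ Im ψ(¼+iω/2) + Σ_k wt(Re χ sin + Im χ cos)(ω ℓ_k) − T)(κ_i)/π`, `s_i = (−1)^{κ_i}`.
★ `hS_of_checkCellC` — literally the door's `hS` with `J := 1`, `lam := fun _ ↦ 1`, `θ := θN/θD`, `η := ηN/ηD`,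
`d₀ := d0N/2^wbits`, `w j := wN[(j+1)/2 − B]/2^wbits`, `M i i' := Re G^χ(κ_i, κ_{i'})`, following `hSe_of_checkCellE` (PsdDyadic.psd_of_checkPsdMid + entrywise `mem_`).
VALIDATED NUMERICALLY against certc8.py (EXTREMALS/GRH/formatC-complex-J1-CERT/certc-7.2-log2-J1-8x64.json) in the Gen scratch
HOME/rh-explicit-weil-grh-2/lean/gen10/complex/Gen_C7_cell.lean (see RESUME-gen10 ADDENDUM C).
SPLIT (400-line rule, weil-grh-2 gen13): this file = the kernel functions + soundness parts 1–2 (`mem_entryC`, `mem_schurC`, `mem_fTilBox`, `mem_uC`); the PSD fact, the bridge `hS_of_checkCellC` and the front door `weilPositivityOnChar_of_checkCellC` are in `TwistedGramCellCheckCDoor.lean`.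
-/

set_option autoImplicit false
set_option linter.style.longLine false

open Real Complex Finset
open scoped BigOperators ArithmeticFunction.vonMangoldt ComplexConjugate

namespace Summit.Ventures.WeilGRH

open Literature.NumberTheory.LFunctions Literature.NumberTheory.LFunctions.Yoshida1992
open Literature.NumberTheory.LFunctions.Yoshida1992.Encl
open Literature.Analysis.SpecialFunctions Literature.Analysis.ValidatedNumerics.NumericsMP

namespace TwistedEncl

/-- The mode of the enumeration index: `κ⁻¹ i = (i+1)/2` for odd `i`, `−i/2` for even `i` (`0, 1, −1, 2, −2, …`). [folklore] -/
def modeOfIdx (i : ℕ) : ℤ := if i % 2 = 1 then (((i + 1) / 2 : ℕ) : ℤ) else -(((i / 2 : ℕ)) : ℤ)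

/-- The sign `(−1)^{κ_i}` as an integer. [folklore] -/
def sgnOfIdx (i : ℕ) : ℤ := if (modeOfIdx i).natAbs % 2 = 0 then 1 else -1

/-- The table record of a signed mode: the stored record at `|p|`, flipped for `p < 0`. [folklore] -/
def recOf (tab : List IdxRec) (p : ℤ) : IdxRec := if 0 ≤ p then tget tab p.natAbs else (tget tab p.natAbs).flip

/-- Entry box `M(i,i') ∋ Re G^χ(κ_i, κ_{i'})`. [cite: Yoshida1992HermitianForms, §5 (5.15)-(5.16) p. 301] -/
def entryC (S : ℕ) (C : Consts) (xs ys : List MI) (LQ : MI) (tab : List IdxRec) (i i' : ℕ) : MI :=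
  twistedGramCBox S C xs ys LQ (recOf tab (modeOfIdx i)) (recOf tab (modeOfIdx i')) (modeOfIdx i) (modeOfIdx i')

/-- Schur column sum `Σ_{c<n} M(i, 2B−1+c) M(i', 2B−1+c) · 2^{wbits} / wN[c/2]` (`w_j = wN[(j+1)/2 − B]`, `j = 2B−1+c`).
[cite: Yoshida1992HermitianForms, §7 pp. 305–312] -/
def schurC (S : ℕ) (C : Consts) (xs ys : List MI) (LQ : MI) (tab : List IdxRec) (wbits : ℕ) (wN : List ℕ)
    (B i i' : ℕ) : ℕ → MI
  | 0 => MI.ofInt S 0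
  | c + 1 => (schurC S C xs ys LQ tab wbits wN B i i' c).add
      ((((entryC S C xs ys LQ tab i (2 * B - 1 + c)).mul S (entryC S C xs ys LQ tab i' (2 * B - 1 + c))).mulInt
        ((2 : ℤ) ^ wbits)).divNat (wN.getD (c / 2) 0))

/-- `F̃_i = (½ Im ψ + Σ_k wt(Re χ sin + Im χ cos) − T)(κ_i)/π`, boxed from the (flipped) record. [cite: Yoshida1992HermitianForms, §5 (5.16) p. 301] -/
def fTilBox (S : ℕ) (C : Consts) (xs ys : List MI) (tab : List IdxRec) (i : ℕ) : MI :=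
  let R := recOf tab (modeOfIdx i)
  ((((R.imP.divNat 2).add (primeSumC S xs ys C.wts R.cs C.wts.length)).sub R.eS).mul S C.invPi)

/-- Tail parameters of the complex cell: `θ = θN/θD`, `η = ηN/ηD`. -/
structure CTailData where
  /-- `θ` numerator -/
  θN : ℕ
  /-- `θ` denominator -/
  θD : ℕ
  /-- `η` numerator (AM–GM split of the tail's two rank-one parts) -/
  ηN : ℕ
  /-- `η` denominator -/
  ηD : ℕ
  deriving Repr, Inhabited

/-- The order-1 (`J = 1`) two-sided tail `U(i,i')` of the door, boxed (formula in the module docstring).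
[cite: Yoshida1992HermitianForms, §7 pp. 305–312] -/
def uC (S : ℕ) (C : Consts) (xs ys : List MI) (tab : List IdxRec) (d : CCellData) (e : CTailData) (i i' : ℕ) : MI :=
  let Sig := sigBox S C
  let cpi := d.CC.mul S C.invPi                       -- C/π
  let A := ((C.P.divNat 4).add Sig).add (cpi.divNat d.B3)   -- π/4 + Σ + C/(π B₃)
  let A' := ((C.P.divNat 4).add Sig).add cpi              -- π/4 + Σ + C/π
  let s : ℤ := sgnOfIdx i * sgnOfIdx i'
  -- term 1: (1+θ)(1+η) A² /(π² d₀ (B₃−1)) · s      (d₀ = d0N/2^wbits ⇒ ×2^wbits / d0N)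
  let t1 := ((((((A.mul S A).mul S C.invPi).mul S C.invPi).mulInt ((e.θD : ℤ) + e.θN)).divNat e.θD).mulInt
    ((e.ηD : ℤ) + e.ηN)).divNat e.ηD
  let t1 := ((t1.mulInt (s * 2 ^ d.wbits)).divNat (d.d0N * (d.B3 - 1)))
  -- term 2: (1+θ)(1+η⁻¹)/(d₀(B₃−1)) · s F̃_i F̃_i'
  let F := (fTilBox S C xs ys tab i).mul S (fTilBox S C xs ys tab i')
  let t2 := ((((F.mulInt ((e.θD : ℤ) + e.θN)).divNat e.θD).mulInt ((e.ηN : ℤ) + e.ηD)).divNat e.ηN)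
  let t2 := ((t2.mulInt (s * 2 ^ d.wbits)).divNat (d.d0N * (d.B3 - 1)))
  -- term 3 (diagonal): (1+θ⁻¹)(2B−1)/(3 d₀ (B₃−1)³) (4 A′ |κ_i| /π)²
  let k : ℤ := (modeOfIdx i).natAbs
  let G := ((A'.mul S C.invPi).mulInt (4 * k))
  let t3 := (((((G.mul S G).mulInt ((e.θN : ℤ) + e.θD)).divNat e.θN).mulInt (((2 * d.B - 1 : ℕ) : ℤ) * 2 ^ d.wbits)).divNat
    (3 * d.d0N * (d.B3 - 1) ^ 3))
  ((t1.add t2).add (if i = i' then t3 else MI.ofInt S 0)).mulInt 2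

/-- The boxed entry of the door's matrix `S(i,i') = M − Schur − U`. [cite: Yoshida1992HermitianForms, §7 pp. 305–312] -/
def cellC (S : ℕ) (C : Consts) (xs ys : List MI) (LQ : MI) (tab : List IdxRec) (d : CCellData) (e : CTailData)
    (i i' : ℕ) : MI :=
  ((entryC S C xs ys LQ tab i i').sub (schurC S C xs ys LQ tab d.wbits d.wN d.B i i' (2 * (d.B3 - d.B)))).sub
    (uC S C xs ys tab d e i i')

/-- Header checks (block shape, positivity of the rational data and weights). [cite: Moore1966, Ch. 3 (interval arithmetic: inclusion property)] -/
def checkCellCHead (d : CCellData) (e : CTailData) : Bool :=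
  decide (2 ≤ d.B) && decide (2 * d.B ≤ d.B3) && decide (0 < e.θN) && decide (0 < e.θD) && decide (0 < e.ηN) &&
    decide (0 < e.ηD) && decide (0 < d.d0N) && (List.range (d.B3 - d.B)).all (fun c ↦ decide (0 < d.wN.getD c 0))

/-- Row-range cell check `i₀ ≤ i < i₀ + n` against integer midpoints `D` (unit `2^{−c}`, radius `ρ`), as in `checkCellHRows`.
[cite: Moore1966, Ch. 3 (interval arithmetic: inclusion property)] -/
def checkCellCRows (S : ℕ) (C : Consts) (xs ys : List MI) (LQ : MI) (tab : List IdxRec) (d : CCellData) (e : CTailData)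
    (c : ℕ) (ρ : ℤ) (D : List (List ℤ)) (i0 n : ℕ) : Bool :=
  (List.range' i0 n).all fun i ↦ (List.range (2 * d.B - 1)).all fun i' ↦
    enclCheck S c ρ (PsdDyadic.getMZ D i i') (cellC S C xs ys LQ tab d e i i')


/-! ## Soundness, part 1: records at signed modes, entries, Schur sums, `F̃` (part 2 = `mem_uC`; parts 3–4 = PSD + bridge) -/

variable {S : ℕ} {a : ℝ} {q : ℕ}

/-- The diagonal fields are EVEN in the mode: `DiagValid` at `−n` from `DiagValid` at `n` (flipping touches only the odd fields).
[cite: Moore1966, Ch. 3 (interval arithmetic: inclusion property)] -/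
theorem diagValid_flip_neg {n : ℤ} {R : IdxRec} (h : DiagValid S a n R) : DiagValid S a (-n) R.flip where
  reP := by
    rw [freq_neg, reDigammaQuarter_even]; exact h.reP
  rePD := by
    have e : (((freq a (-n) : ℝ)) : ℂ) = (((-(freq a n) : ℝ)) : ℂ) := by rw [freq_neg]
    rw [e, re_deriv_digamma_quarter_neg]; exact h.rePD
  eD := by
    rw [archExpSumDiag_neg]; exact h.eD

/-- `0 ≤ modeOfIdx i ↔ i` odd or `i = 0`; the natural mode. [folklore] -/
theorem natAbs_modeOfIdx (i : ℕ) : (modeOfIdx i).natAbs = if i % 2 = 1 then (i + 1) / 2 else i / 2 := by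
  unfold modeOfIdx
  split
  · exact Int.natAbs_natCast _
  · rw [Int.natAbs_neg]; exact Int.natAbs_natCast _

/-- The record of a signed mode is off-diagonally valid (table valid below `N > |p|`). [cite: Moore1966, Ch. 3 (interval arithmetic: inclusion property)] -/
theorem offValid_recOf {ks : List PrimeLen} {N : ℕ} {tab : List IdxRec} (hT : TabValid S a ks N tab) {p : ℤ}
    (hp : p.natAbs < N) : OffValid S a ks p (recOf tab p) := by
  unfold recOf
  by_cases h0 : 0 ≤ p
  · rw [if_pos h0]
    have e : ((p.natAbs : ℕ) : ℤ) = p := Int.natAbs_of_nonneg h0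
    have h := (hT p.natAbs hp).1
    rw [e] at h; exact h
  · rw [if_neg h0]
    have e : ((p.natAbs : ℕ) : ℤ) = -p := Int.ofNat_natAbs_of_nonpos (le_of_lt (not_le.mp h0))
    have h := ((hT p.natAbs hp).1).flip
    rw [e, neg_neg] at h; exact h

/-- The record of a signed mode is diagonally valid. [cite: Moore1966, Ch. 3 (interval arithmetic: inclusion property)] -/
theorem diagValid_recOf {ks : List PrimeLen} {N : ℕ} {tab : List IdxRec} (hT : TabValid S a ks N tab) {p : ℤ}
    (hp : p.natAbs < N) : DiagValid S a p (recOf tab p) := by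
  unfold recOf
  by_cases h0 : 0 ≤ p
  · rw [if_pos h0]
    have e : ((p.natAbs : ℕ) : ℤ) = p := Int.natAbs_of_nonneg h0
    have h := (hT p.natAbs hp).2
    rw [e] at h; exact h
  · rw [if_neg h0]
    have e : ((p.natAbs : ℕ) : ℤ) = -p := Int.ofNat_natAbs_of_nonpos (le_of_lt (not_le.mp h0))
    have h := diagValid_flip_neg (hT p.natAbs hp).2
    rw [e, neg_neg] at h; exact h

/-- `|κ_i| < N` when `i < 2N − 1`. [folklore] -/
theorem natAbs_modeOfIdx_lt {i N : ℕ} (hi : i < 2 * N - 1) : (modeOfIdx i).natAbs < N := by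
  rw [natAbs_modeOfIdx]; split <;> omega

/-- `entryC ∋ Re G^χ(κ_i, κ_{i'})` for a table valid below `N`, `i, i' < 2N − 1`. [cite: Moore1966, Ch. 3 (interval arithmetic: inclusion property)] -/
theorem mem_entryC (hS : 0 < S) (ha0 : 0 < a) {ks : List PrimeLen} (hks : PrimeData a ks) {C : Consts}
    (hC : ConstsValid S a ks C) (χ : DirichletCharacter ℂ q) {xs ys : List MI}
    (hx : ∀ i < ks.length, MI.mem S (χ (((ks.getD i default).val : ℕ) : ZMod q)).re (xs.getD i default))
    (hy : ∀ i < ks.length, MI.mem S (χ (((ks.getD i default).val : ℕ) : ZMod q)).im (ys.getD i default))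
    {LQ : MI} (hLQ : MI.mem S (Real.log q) LQ) {N : ℕ} {tab : List IdxRec} (hT : TabValid S a ks N tab)
    {i i' : ℕ} (hi : i < 2 * N - 1) (hi' : i' < 2 * N - 1) :
    MI.mem S ((twistedGramCoeffC χ a (modeOfIdx i) (modeOfIdx i')).re) (entryC S C xs ys LQ tab i i') := by
  unfold entryC
  exact mem_twistedGramCBox hS ha0 hks hC χ hx hy hLQ (offValid_recOf hT (natAbs_modeOfIdx_lt hi))
    (fun _ ↦ diagValid_recOf hT (natAbs_modeOfIdx_lt hi)) (offValid_recOf hT (natAbs_modeOfIdx_lt hi'))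

/-- Weight index of the column `j = 2B−1+c`: `(j+1)/2 − B = c/2` (`1 ≤ B`). [folklore] -/
theorem colWeightIdx {B : ℕ} (hB : 1 ≤ B) (c : ℕ) : (2 * B - 1 + c + 1) / 2 - B = c / 2 := by omega

/-- Soundness of `schurC`: the column sum over `j = 2B−1+c`, `c < n`, with weights `w_j = wN[(j+1)/2 − B]·2^{−wbits}`.
[cite: Moore1966, Ch. 3 (interval arithmetic: inclusion property)] -/
theorem mem_schurC (hS : 0 < S) (ha0 : 0 < a) {ks : List PrimeLen} (hks : PrimeData a ks) {C : Consts}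
    (hC : ConstsValid S a ks C) (χ : DirichletCharacter ℂ q) {xs ys : List MI}
    (hx : ∀ i < ks.length, MI.mem S (χ (((ks.getD i default).val : ℕ) : ZMod q)).re (xs.getD i default))
    (hy : ∀ i < ks.length, MI.mem S (χ (((ks.getD i default).val : ℕ) : ZMod q)).im (ys.getD i default))
    {LQ : MI} (hLQ : MI.mem S (Real.log q) LQ) {N : ℕ} {tab : List IdxRec} (hT : TabValid S a ks N tab)
    {wbits : ℕ} {wN : List ℕ} {B i i' : ℕ} (hB : 1 ≤ B) (hi : i < 2 * N - 1) (hi' : i' < 2 * N - 1) :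
    ∀ n, 2 * B - 1 + n ≤ 2 * N - 1 → (∀ c < n, 0 < wN.getD (c / 2) 0) →
      MI.mem S (∑ c ∈ Finset.range n,
        (twistedGramCoeffC χ a (modeOfIdx i) (modeOfIdx (2 * B - 1 + c))).re *
          (twistedGramCoeffC χ a (modeOfIdx i') (modeOfIdx (2 * B - 1 + c))).re /
          ((wN.getD (c / 2) 0 : ℝ) / 2 ^ wbits))
        (schurC S C xs ys LQ tab wbits wN B i i' n)
  | 0, _, _ => by simpa [schurC] using MI.mem_ofInt S 0
  | n + 1, hn, hw => by
      rw [Finset.sum_range_succ, schurC]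
      have hjN : 2 * B - 1 + n < 2 * N - 1 := by omega
      have hwn : 0 < wN.getD (n / 2) 0 := hw n (by omega)
      refine MI.mem_add (mem_schurC hS ha0 hks hC χ hx hy hLQ hT hB hi hi' n (by omega) (fun c hc ↦ hw c (by omega))) ?_
      have h := MI.mem_divNat (MI.mem_mulInt (MI.mem_mul hS
        (mem_entryC hS ha0 hks hC χ hx hy hLQ hT hi hjN) (mem_entryC hS ha0 hks hC χ hx hy hLQ hT hi' hjN))
        ((2 : ℤ) ^ wbits)) hwn
      refine mem_of_eq h ?_
      have hw0 : (wN.getD (n / 2) 0 : ℝ) ≠ 0 := by exact_mod_cast hwn.ne'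
      push_cast
      field_simp

/-- `fTilBox ∋ F̃_i = (½ Im ψ(¼+iω/2) + Σ_k wt(Re χ sin + Im χ cos)(ω_{κ_i} log k) − T_{κ_i})/π`.
[cite: Moore1966, Ch. 3 (interval arithmetic: inclusion property)] -/
theorem mem_fTilBox (hS : 0 < S) {ks : List PrimeLen} (hks : PrimeData a ks) {C : Consts} (hC : ConstsValid S a ks C)
    (χ : DirichletCharacter ℂ q) {xs ys : List MI}
    (hx : ∀ i < ks.length, MI.mem S (χ (((ks.getD i default).val : ℕ) : ZMod q)).re (xs.getD i default))
    (hy : ∀ i < ks.length, MI.mem S (χ (((ks.getD i default).val : ℕ) : ZMod q)).im (ys.getD i default))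
    {N : ℕ} {tab : List IdxRec} (hT : TabValid S a ks N tab) {i : ℕ} (hi : i < 2 * N - 1) :
    MI.mem S (((Complex.digamma (1 / 4 + ((freq a (modeOfIdx i) : ℝ) : ℂ) / 2 * Complex.I)).im / 2
        + (∑ k ∈ weilPrimeIndex a, (ArithmeticFunction.vonMangoldt k : ℝ) / Real.sqrt k *
            ((χ (k : ZMod q)).re * Real.sin (freq a (modeOfIdx i) * Real.log k) +
              (χ (k : ZMod q)).im * Real.cos (freq a (modeOfIdx i) * Real.log k)))
        - archExpSumSin a (modeOfIdx i)) / Real.pi)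
      (fTilBox S C xs ys tab i) := by
  unfold fTilBox
  rw [hC.wts_len]
  have hR := offValid_recOf hT (natAbs_modeOfIdx_lt hi) (ks := ks)
  have hlist := sum_weilPrimeIndex_eq_listSum hks (fun k ↦
    (χ (k : ZMod q)).re * Real.sin (freq a (modeOfIdx i) * Real.log k) + (χ (k : ZMod q)).im * Real.cos (freq a (modeOfIdx i) * Real.log k))
  rw [list_sum_map_eq_sum_range] at hlist
  simp only [PrimeLen.log_val] at hlist
  rw [hlist]
  have hpri := mem_primeSumC hS hC χ hx hy hR ks.length le_rfl
  have h := MI.mem_mul hS (MI.mem_sub (MI.mem_add (MI.mem_divNat hR.imP (n := 2) (by norm_num)) hpri) hR.eS) hC.invPi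
  refine mem_of_eq h ?_
  push_cast
  ring


/-! ## Soundness, part 2: the tail box `uC` -/

/-- The real order-1 (`J = 1`) two-sided tail `U(i,i')` in closed form (module docstring), with `s_i = sgnOfIdx i`, `k_i = |κ_i|`,
`F` = the function `i ↦ F̃_i`. [cite: Yoshida1992HermitianForms, §7 pp. 305–312] -/
noncomputable def uCReal (Sig Cc θ η d0 : ℝ) (B B3 : ℕ) (F : ℕ → ℝ) (i i' : ℕ) : ℝ :=
  2 * ((1 + θ) * (1 + η) * (Real.pi / 4 + Sig + Cc / Real.pi / B3) ^ 2 / Real.pi ^ 2 / (d0 * ((B3 - 1 : ℕ) : ℝ)) *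
        (((sgnOfIdx i : ℤ) : ℝ) * ((sgnOfIdx i' : ℤ) : ℝ)) +
      (1 + θ) * (1 + η⁻¹) / (d0 * ((B3 - 1 : ℕ) : ℝ)) * (((sgnOfIdx i : ℤ) : ℝ) * ((sgnOfIdx i' : ℤ) : ℝ)) * (F i * F i') +
      (if i = i' then (1 + θ⁻¹) * (((2 * B - 1 : ℕ) : ℝ) / (3 * d0 * ((B3 - 1 : ℕ) : ℝ) ^ 3)) *
        (4 * (Real.pi / 4 + Sig + Cc / Real.pi) * ((((modeOfIdx i).natAbs : ℕ) : ℤ) : ℝ) / Real.pi) ^ 2 else 0))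

/-- Soundness of `uC`. [cite: Moore1966, Ch. 3 (interval arithmetic: inclusion property)] -/
theorem mem_uC (hS : 0 < S) {ks : List PrimeLen} (hks : PrimeData a ks) {C : Consts} (hC : ConstsValid S a ks C)
    (χ : DirichletCharacter ℂ q) {xs ys : List MI}
    (hx : ∀ i < ks.length, MI.mem S (χ (((ks.getD i default).val : ℕ) : ZMod q)).re (xs.getD i default))
    (hy : ∀ i < ks.length, MI.mem S (χ (((ks.getD i default).val : ℕ) : ZMod q)).im (ys.getD i default))
    {N : ℕ} {tab : List IdxRec} (hT : TabValid S a ks N tab) {d : CCellData} {e : CTailData}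
    (hθN : 0 < e.θN) (hθD : 0 < e.θD) (hηN : 0 < e.ηN) (hηD : 0 < e.ηD) (hd0 : 0 < d.d0N) (hB3 : 2 ≤ d.B3) (hB30 : 0 < d.B3)
    {Cc : ℝ} (hCC : MI.mem S Cc d.CC) {i i' : ℕ} (hi : i < 2 * N - 1) (hi' : i' < 2 * N - 1) :
    MI.mem S (uCReal (∑ k ∈ weilPrimeIndex a, (ArithmeticFunction.vonMangoldt k : ℝ) / Real.sqrt k) Cc
        ((e.θN : ℝ) / e.θD) ((e.ηN : ℝ) / e.ηD) ((d.d0N : ℝ) / 2 ^ d.wbits) d.B d.B3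
        (fun i ↦ ((Complex.digamma (1 / 4 + ((freq a (modeOfIdx i) : ℝ) : ℂ) / 2 * Complex.I)).im / 2
          + (∑ k ∈ weilPrimeIndex a, (ArithmeticFunction.vonMangoldt k : ℝ) / Real.sqrt k *
              ((χ (k : ZMod q)).re * Real.sin (freq a (modeOfIdx i) * Real.log k) +
                (χ (k : ZMod q)).im * Real.cos (freq a (modeOfIdx i) * Real.log k)))
          - archExpSumSin a (modeOfIdx i)) / Real.pi) i i')
      (uC S C xs ys tab d e i i') := by
  set Sig := ∑ k ∈ weilPrimeIndex a, (ArithmeticFunction.vonMangoldt k : ℝ) / Real.sqrt k with hSigdef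
  have hSig : MI.mem S Sig (sigBox S C) := mem_sigBox hks hC
  have hπ := hC.invPi
  have hP := hC.pi
  have hB31 : 0 < d.B3 - 1 := by omega
  have hcpi : MI.mem S (Cc / Real.pi) (d.CC.mul S C.invPi) := mem_of_eq (MI.mem_mul hS hCC hπ) (by ring)
  have hA : MI.mem S (Real.pi / 4 + Sig + Cc / Real.pi / d.B3)
      (((C.P.divNat 4).add (sigBox S C)).add ((d.CC.mul S C.invPi).divNat d.B3)) :=
    mem_of_eq (MI.mem_add (MI.mem_add (MI.mem_divNat hP (n := 4) (by norm_num)) hSig) (MI.mem_divNat hcpi hB30))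
      (by push_cast; ring)
  have hA' : MI.mem S (Real.pi / 4 + Sig + Cc / Real.pi) (((C.P.divNat 4).add (sigBox S C)).add (d.CC.mul S C.invPi)) :=
    mem_of_eq (MI.mem_add (MI.mem_add (MI.mem_divNat hP (n := 4) (by norm_num)) hSig) hcpi) (by push_cast; ring)
  have hF := mem_fTilBox hS hks hC χ hx hy hT hi
  have hF' := mem_fTilBox hS hks hC χ hx hy hT hi'
  have hθD' : (e.θD : ℝ) ≠ 0 := by exact_mod_cast hθD.ne'
  have hθN' : (e.θN : ℝ) ≠ 0 := by exact_mod_cast hθN.ne'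
  have hηD' : (e.ηD : ℝ) ≠ 0 := by exact_mod_cast hηD.ne'
  have hηN' : (e.ηN : ℝ) ≠ 0 := by exact_mod_cast hηN.ne'
  have hd0' : (d.d0N : ℝ) ≠ 0 := by exact_mod_cast hd0.ne'
  have hB3r : ((d.B3 - 1 : ℕ) : ℝ) ≠ 0 := by exact_mod_cast hB31.ne'
  have hB3r' : (d.B3 : ℝ) ≠ 0 := by exact_mod_cast hB30.ne'
  have hπ0 : (Real.pi : ℝ) ≠ 0 := Real.pi_ne_zero
  -- term 1
  have h1 := MI.mem_divNat (MI.mem_mulInt (MI.mem_divNat (MI.mem_mulInt (MI.mem_divNat (MI.mem_mulInt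
    (MI.mem_mul hS (MI.mem_mul hS (MI.mem_mul hS hA hA) hπ) hπ) ((e.θD : ℤ) + e.θN)) hθD) ((e.ηD : ℤ) + e.ηN)) hηD)
    (sgnOfIdx i * sgnOfIdx i' * 2 ^ d.wbits)) (n := d.d0N * (d.B3 - 1)) (Nat.mul_pos hd0 hB31)
  -- term 2
  have h2 := MI.mem_divNat (MI.mem_mulInt (MI.mem_divNat (MI.mem_mulInt (MI.mem_divNat (MI.mem_mulInt
    (MI.mem_mul hS hF hF') ((e.θD : ℤ) + e.θN)) hθD) ((e.ηN : ℤ) + e.ηD)) hηN)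
    (sgnOfIdx i * sgnOfIdx i' * 2 ^ d.wbits)) (n := d.d0N * (d.B3 - 1)) (Nat.mul_pos hd0 hB31)
  -- term 3
  have hG := MI.mem_mulInt (MI.mem_mul hS hA' hπ) (4 * ((modeOfIdx i).natAbs : ℤ))
  have h3 := MI.mem_divNat (MI.mem_mulInt (MI.mem_divNat (MI.mem_mulInt (MI.mem_mul hS hG hG) ((e.θN : ℤ) + e.θD)) hθN)
    (((2 * d.B - 1 : ℕ) : ℤ) * 2 ^ d.wbits)) (n := 3 * d.d0N * (d.B3 - 1) ^ 3)
    (Nat.mul_pos (Nat.mul_pos (by norm_num) hd0) (pow_pos hB31 3))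
  unfold uC
  simp only []
  by_cases hii : i = i'
  · rw [if_pos hii]
    refine mem_of_eq (MI.mem_mulInt (MI.mem_add (MI.mem_add h1 h2) h3) 2) ?_
    unfold uCReal
    rw [if_pos hii]
    push_cast
    field_simp
    try ring
  · rw [if_neg hii]
    refine mem_of_eq (MI.mem_mulInt (MI.mem_add (MI.mem_add h1 h2) (MI.mem_ofInt S 0)) 2) ?_
    unfold uCReal
    rw [if_neg hii]
    push_cast
    field_simp
    try ring


end TwistedEncl

end Summit.Ventures.WeilGRH
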